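import Literature.NumberTheory.Sieve.SmoothPlateauCutoff
import HarnessLib

/-!
# The smooth dyadic partition of unity `∑_j F(x/2^j) = 1`

Topic `Literature/NumberTheory/Sieve` (source-independent analytic tool), companion of
`SmoothPlateauCutoff.lean`. Matomäki–Merikoski (arXiv:2112.11412), §7: "We make a smooth partition
of the variables `m_j`. We let `Ψ : ℝ → [0, 1]` be a smooth function for which `Ψ(x) = 0` for
`x ≤ 1` and `Ψ(x) = 1` for `x ≥ 2`. Define then `F : ℝ₊ → [0, 1]` by `F(x) = Ψ(x)` if
`0 < x ≤ 2`, `F(x) = 1 − Ψ(x/2)` if `x > 2`. The function `F(x)` is supported on `[1, 4]` and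
gives a smooth partition of unity `∑_{j ∈ ℤ} F(x/2^j) = 1` for all `x > 0`." This file constructs
`Ψ` and `F` concretely (two DEFINITIONS) and PROVES the listed properties with quantitative
derivative bounds:

* `smoothStep x = ψ(x − 1)` (`ψ = Real.smoothTransition`): smooth, monotone, `= 0` for `x ≤ 1`,
  `= 1` for `x ≥ 2`, values in `[0, 1]`;
* `dyadicBump x = Ψ(x) − Ψ(x/2)`, which is the source's `F` (`dyadicBump_eq_smoothStep` on
  `x ≤ 2`, `dyadicBump_eq_one_sub` on `x ≥ 2`): smooth, values in `[0, 1]`, `= 0` off `(1, 4)`,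
  `tsupport ⊆ [1, 4]`, compact support;
* `sum_Icc_dyadicBump` — the telescoping identity `∑_{a ≤ j ≤ b} F(x/2^j) = Ψ(x/2^a) − Ψ(x/2^{b+1})`
  (`j ∈ ℤ`), hence `= 1` when `x/2^a ≥ 2` and `x/2^{b+1} ≤ 1` (`sum_Icc_dyadicBump_eq_one`) and
  `= 0` when `x/2^a ≤ 1` or `x/2^{b+1} ≥ 2` — the finite forms of `∑_{j ∈ ℤ} F(x/2^j) = 1` and of
  "`∑_{M = 2^i, 1/4 ≤ M ≤ X^{1/2}} F(m/M) = 1` if `m ≤ X^{1/2}/4`, `= 0` if `m ≥ 4X^{1/2}`" (§7);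
* `iteratedDeriv_dyadicBump`, `norm_iteratedDeriv_dyadicBump_le`: `F⁽ⁿ⁾(x) = Ψ⁽ⁿ⁾(x) − 2⁻ⁿΨ⁽ⁿ⁾(x/2)`,
  `|F⁽ⁿ⁾| ≤ 2Kₙ` (`Kₙ = BFI.derivConst n`).

Relation to the tree: `Literature/Analysis/Calculus/WhitneyConvexPartition.lean` has the mirror-image
bump `WhitneyConvex.dyadicBump s = χ(s) − χ(2s)`, `χ(s) = ψ(2 − s)`, supported in `(1/2, 2)`, with
`ℕ`-indexed telescoping and derivative bounds chosen by `Classical.choose`, inside the Whitney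
extension development (regularized distances); the present file is the light-weight version with
the source's normalisation (support `[1, 4]`, `ℤ`-indexed scales `2^j`, explicit constants
`2·BFI.derivConst n`) for the number-theoretic files.

## References

* K. Matomäki, J. Merikoski, IMRN 2023 (arXiv:2112.11412), §7 (the functions `Ψ`, `F`).
  [cite: MatomakiMerikoski2023, §7]
-/

noncomputable section

open Real Set Finset
open scoped ContDiff Topology

namespace Literature.NumberTheory.Sieve

open BFI (derivConst one_le_derivConst norm_iteratedDeriv_smoothTransition_le)

/-! ### The step `Ψ` -/

/-- **The smooth step** `Ψ(x) = ψ(x − 1)`, `ψ = Real.smoothTransition`: "a smooth function for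
which `Ψ(x) = 0` for `x ≤ 1` and `Ψ(x) = 1` for `x ≥ 2`". [cite: MatomakiMerikoski2023, §7] -/
def smoothStep (x : ℝ) : ℝ := Real.smoothTransition (x - 1)

/-- Unfolding. [folklore] -/
theorem smoothStep_def (x : ℝ) : smoothStep x = Real.smoothTransition (x - 1) := rfl

/-- `Ψ(x) = 0` for `x ≤ 1`. [cite: MatomakiMerikoski2023, §7] -/
theorem smoothStep_of_le_one {x : ℝ} (hx : x ≤ 1) : smoothStep x = 0 :=
  Real.smoothTransition.zero_of_nonpos (by linarith)

/-- `Ψ(x) = 1` for `x ≥ 2`. [cite: MatomakiMerikoski2023, §7] -/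
theorem smoothStep_of_two_le {x : ℝ} (hx : 2 ≤ x) : smoothStep x = 1 :=
  Real.smoothTransition.one_of_one_le (by linarith)

/-- `0 ≤ Ψ`. [folklore] -/
theorem smoothStep_nonneg (x : ℝ) : 0 ≤ smoothStep x := Real.smoothTransition.nonneg _

/-- `Ψ ≤ 1`. [folklore] -/
theorem smoothStep_le_one (x : ℝ) : smoothStep x ≤ 1 := Real.smoothTransition.le_one _

/-- `Ψ` is monotone. [folklore] -/
theorem smoothStep_monotone : Monotone smoothStep := fun _ _ h =>
  Real.smoothTransition.monotone (by linarith)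

/-- `Ψ` is smooth. [folklore] -/
theorem contDiff_smoothStep : ContDiff ℝ ∞ smoothStep :=
  Real.smoothTransition.contDiff.comp (contDiff_id.sub contDiff_const)

/-! ### The dyadic bump `F` -/

/-- **The dyadic bump** `F(x) = Ψ(x) − Ψ(x/2)`; this is the source's `F` ("`F(x) = Ψ(x)` if
`0 < x ≤ 2`, `1 − Ψ(x/2)` if `x > 2`", see `dyadicBump_eq_smoothStep`, `dyadicBump_eq_one_sub`),
supported on `[1, 4]` and giving the partition of unity `∑_{j ∈ ℤ} F(x/2^j) = 1`.
[cite: MatomakiMerikoski2023, §7] -/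
def dyadicBump (x : ℝ) : ℝ := smoothStep x - smoothStep (x / 2)

/-- Unfolding. [folklore] -/
theorem dyadicBump_def (x : ℝ) : dyadicBump x = smoothStep x - smoothStep (x / 2) := rfl

/-- On `x ≤ 2`: `F(x) = Ψ(x)`. [cite: MatomakiMerikoski2023, §7] -/
theorem dyadicBump_eq_smoothStep {x : ℝ} (hx : x ≤ 2) : dyadicBump x = smoothStep x := by
  rw [dyadicBump_def, smoothStep_of_le_one (show x / 2 ≤ 1 by linarith), sub_zero]

/-- On `x ≥ 2`: `F(x) = 1 − Ψ(x/2)`. [cite: MatomakiMerikoski2023, §7] -/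
theorem dyadicBump_eq_one_sub {x : ℝ} (hx : 2 ≤ x) : dyadicBump x = 1 - smoothStep (x / 2) := by
  rw [dyadicBump_def, smoothStep_of_two_le hx]

/-- `F(x) = 0` for `x ≤ 1`. [cite: MatomakiMerikoski2023, §7] -/
theorem dyadicBump_of_le_one {x : ℝ} (hx : x ≤ 1) : dyadicBump x = 0 := by
  rw [dyadicBump_def, smoothStep_of_le_one hx, smoothStep_of_le_one (by linarith), sub_zero]

/-- `F(x) = 0` for `x ≥ 4`. [cite: MatomakiMerikoski2023, §7] -/
theorem dyadicBump_of_four_le {x : ℝ} (hx : 4 ≤ x) : dyadicBump x = 0 := by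
  rw [dyadicBump_def, smoothStep_of_two_le (by linarith), smoothStep_of_two_le (by linarith), sub_self]

/-- `0 ≤ F` (monotonicity of `Ψ` for `x ≥ 0`; both terms vanish for `x ≤ 1`). [folklore] -/
theorem dyadicBump_nonneg (x : ℝ) : 0 ≤ dyadicBump x := by
  rcases le_or_gt x 1 with hx | hx
  · rw [dyadicBump_of_le_one hx]
  · rw [dyadicBump_def, sub_nonneg]
    exact smoothStep_monotone (by linarith)

/-- `F ≤ 1`. [folklore] -/
theorem dyadicBump_le_one (x : ℝ) : dyadicBump x ≤ 1 := by
  rw [dyadicBump_def]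
  linarith [smoothStep_le_one x, smoothStep_nonneg (x / 2)]

/-- `|F| ≤ 1`. [folklore] -/
theorem abs_dyadicBump_le_one (x : ℝ) : |dyadicBump x| ≤ 1 :=
  abs_le.mpr ⟨by linarith [dyadicBump_nonneg x], dyadicBump_le_one x⟩

/-- `F` is smooth. [folklore] -/
theorem contDiff_dyadicBump : ContDiff ℝ ∞ dyadicBump :=
  contDiff_smoothStep.sub (contDiff_smoothStep.comp (contDiff_id.div_const 2))

/-- The support of `F` lies in `(1, 4)`. [folklore] -/
theorem support_dyadicBump_subset : Function.support dyadicBump ⊆ Ioo 1 4 := by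
  intro x hx
  rw [Function.mem_support] at hx
  rw [Set.mem_Ioo]
  constructor
  · by_contra h; exact hx (dyadicBump_of_le_one (not_lt.mp h))
  · by_contra h; exact hx (dyadicBump_of_four_le (not_lt.mp h))

/-- `tsupport F ⊆ [1, 4]` ("The function `F(x)` is supported on `[1, 4]`"). [cite: MatomakiMerikoski2023, §7] -/
theorem tsupport_dyadicBump_subset : tsupport dyadicBump ⊆ Icc 1 4 :=
  closure_minimal (support_dyadicBump_subset.trans Ioo_subset_Icc_self) isClosed_Icc

/-- `F` has compact support. [folklore] -/
theorem hasCompactSupport_dyadicBump : HasCompactSupport dyadicBump :=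
  HasCompactSupport.of_support_subset_isCompact isCompact_Icc
    (support_dyadicBump_subset.trans Ioo_subset_Icc_self)

/-! ### The partition of unity -/

/-- **Telescoping**: `∑_{a ≤ j ≤ b} F(x/2^j) = Ψ(x/2^a) − Ψ(x/2^{b+1})` for integers `a ≤ b`
(`F(x/2^j) = Ψ(x/2^j) − Ψ(x/2^{j+1})`). [cite: MatomakiMerikoski2023, §7] -/
theorem sum_Icc_dyadicBump {a b : ℤ} (hab : a ≤ b) (x : ℝ) :
    ∑ j ∈ Finset.Icc a b, dyadicBump (x / (2 : ℝ) ^ j) =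
      smoothStep (x / (2 : ℝ) ^ a) - smoothStep (x / (2 : ℝ) ^ (b + 1)) := by
  -- induction on `n = b - a`
  obtain ⟨n, rfl⟩ : ∃ n : ℕ, b = a + n := ⟨(b - a).toNat, by rw [Int.toNat_of_nonneg (by linarith)]; ring⟩
  clear hab
  induction n with
  | zero =>
    simp only [Nat.cast_zero, add_zero, Finset.Icc_self, Finset.sum_singleton, dyadicBump_def]
    congr 2
    rw [zpow_add₀ (two_ne_zero), zpow_one, div_div]
  | succ n ih =>
    rw [show a + ((n + 1 : ℕ) : ℤ) = a + (n : ℕ) + 1 by push_cast; ring,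
      ← Finset.insert_Icc_right_eq_Icc_add_one (by linarith), Finset.sum_insert (by simp),
      ih, dyadicBump_def]
    have e1 : x / (2 : ℝ) ^ (a + (n : ℕ) + 1) / 2 = x / (2 : ℝ) ^ (a + (n : ℕ) + 1 + 1) := by
      rw [zpow_add₀ (two_ne_zero) (a + (n : ℕ) + 1) 1, zpow_one, div_div]
    rw [e1]
    ring

/-- **`∑_{a ≤ j ≤ b} F(x/2^j) = 1`** when `x/2^a ≥ 2` and `x/2^{b+1} ≤ 1` (the finite form of
`∑_{j ∈ ℤ} F(x/2^j) = 1` for `x > 0`). [cite: MatomakiMerikoski2023, §7] -/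
theorem sum_Icc_dyadicBump_eq_one {a b : ℤ} (hab : a ≤ b) {x : ℝ} (ha : 2 ≤ x / (2 : ℝ) ^ a)
    (hb : x / (2 : ℝ) ^ (b + 1) ≤ 1) :
    ∑ j ∈ Finset.Icc a b, dyadicBump (x / (2 : ℝ) ^ j) = 1 := by
  rw [sum_Icc_dyadicBump hab, smoothStep_of_two_le ha, smoothStep_of_le_one hb, sub_zero]

/-- The sum vanishes when `x/2^a ≤ 1` (all scales `2^j`, `j ≥ a`, are too large).
[cite: MatomakiMerikoski2023, §7] -/
theorem sum_Icc_dyadicBump_eq_zero_of_le {a b : ℤ} (hab : a ≤ b) {x : ℝ} (hx : 0 ≤ x)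
    (ha : x / (2 : ℝ) ^ a ≤ 1) :
    ∑ j ∈ Finset.Icc a b, dyadicBump (x / (2 : ℝ) ^ j) = 0 := by
  rw [sum_Icc_dyadicBump hab, smoothStep_of_le_one ha, smoothStep_of_le_one, sub_zero]
  refine le_trans ?_ ha
  refine div_le_div_of_nonneg_left hx (zpow_pos two_pos _) ?_
  exact zpow_le_zpow_right₀ one_le_two (by linarith)

/-- The sum vanishes when `x/2^{b+1} ≥ 2` (all scales `2^j`, `j ≤ b`, are too small).
[cite: MatomakiMerikoski2023, §7] -/
theorem sum_Icc_dyadicBump_eq_zero_of_ge {a b : ℤ} (hab : a ≤ b) {x : ℝ}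
    (hb : 2 ≤ x / (2 : ℝ) ^ (b + 1)) :
    ∑ j ∈ Finset.Icc a b, dyadicBump (x / (2 : ℝ) ^ j) = 0 := by
  rw [sum_Icc_dyadicBump hab, smoothStep_of_two_le hb, smoothStep_of_two_le, sub_self]
  refine le_trans hb ?_
  have hx : 0 ≤ x := by
    have h2 : 0 < (2 : ℝ) ^ (b + 1) := zpow_pos two_pos _
    have : 0 ≤ x / (2 : ℝ) ^ (b + 1) := by linarith
    exact (div_nonneg_iff.mp this).elim (fun h => h.1) (fun h => absurd h2 (not_lt.mpr h.2))
  refine div_le_div_of_nonneg_left hx (zpow_pos two_pos _) ?_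
  exact zpow_le_zpow_right₀ one_le_two (by linarith)

/-! ### Derivatives -/

/-- `Ψ⁽ⁿ⁾(x) = ψ⁽ⁿ⁾(x − 1)`. [folklore] -/
theorem iteratedDeriv_smoothStep (n : ℕ) (x : ℝ) :
    iteratedDeriv n smoothStep x = iteratedDeriv n Real.smoothTransition (x - 1) := by
  have h := congrFun (iteratedDeriv_comp_sub_const n Real.smoothTransition 1) x
  exact h

/-- `|Ψ⁽ⁿ⁾| ≤ Kₙ`. [folklore] -/
theorem norm_iteratedDeriv_smoothStep_le {i n : ℕ} (hi : i ≤ n) (x : ℝ) :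
    ‖iteratedDeriv i smoothStep x‖ ≤ derivConst n := by
  rw [iteratedDeriv_smoothStep]
  exact norm_iteratedDeriv_smoothTransition_le hi _

/-- `F⁽ⁿ⁾(x) = Ψ⁽ⁿ⁾(x) − 2⁻ⁿ Ψ⁽ⁿ⁾(x/2)`. [folklore] -/
theorem iteratedDeriv_dyadicBump (n : ℕ) (x : ℝ) :
    iteratedDeriv n dyadicBump x =
      iteratedDeriv n smoothStep x - (2⁻¹ : ℝ) ^ n * iteratedDeriv n smoothStep (x / 2) := by
  have hΨ : ContDiff ℝ n smoothStep := contDiff_smoothStep.of_le (by exact_mod_cast le_top)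
  set g₂ : ℝ → ℝ := fun x => smoothStep (2⁻¹ * x) with hg₂
  have hc₂ : ContDiff ℝ n g₂ := hΨ.comp (contDiff_const.mul contDiff_id)
  have hfun : dyadicBump = fun x => smoothStep x - g₂ x := by
    funext v; simp only [dyadicBump_def, hg₂]; congr 1; rw [inv_mul_eq_div]
  rw [hfun, iteratedDeriv_fun_sub hΨ.contDiffAt hc₂.contDiffAt]
  congr 1
  have h := congrFun (iteratedDeriv_comp_const_mul hΨ (2⁻¹ : ℝ)) x
  rw [hg₂]
  rw [h, inv_mul_eq_div]

/-- **`|F⁽ⁿ⁾| ≤ 2Kₙ`** for every `n` (`Kₙ = BFI.derivConst n`). [folklore] -/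
theorem norm_iteratedDeriv_dyadicBump_le (n : ℕ) (x : ℝ) :
    ‖iteratedDeriv n dyadicBump x‖ ≤ 2 * derivConst n := by
  rw [iteratedDeriv_dyadicBump]
  refine (norm_sub_le _ _).trans ?_
  rw [norm_mul, norm_pow, norm_inv, Real.norm_ofNat]
  have h1 := norm_iteratedDeriv_smoothStep_le (le_refl n) x
  have h2 := norm_iteratedDeriv_smoothStep_le (le_refl n) (x / 2)
  have h3 : (2⁻¹ : ℝ) ^ n ≤ 1 := pow_le_one₀ (by norm_num) (by norm_num)
  have h4 : 0 ≤ (2⁻¹ : ℝ) ^ n := by positivity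
  have hK : 0 ≤ derivConst n := le_trans zero_le_one (one_le_derivConst n)
  nlinarith [mul_le_mul h3 h2 (norm_nonneg _) zero_le_one]

end Literature.NumberTheory.Sieve
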